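import Summits.KontsevichZagierPeriods.Zeta5Search.Certificates.RecordRayGrowthUpper
import HarnessLib

/-!
# ζ(5) search — certificates: the record ray's effective exponent from ONE-SIDED bounds (certifier 2)

HONEST FRAMING: systematic search; no irrationality claim unless certified.

OUR work (Summit side). Brown–Zudilin's Theorem 1 (arXiv:2210.03391) is an EXPONENT statement for explicit
approximations: `|ζ(5) − pₙ/qₙ| < qₙ^{−γ}` with `γ = 0.86` (worthiness `(C₁−C₀)/C₁`, Literature
`BrownZudilin2022.worthiness`, `abs_sub_div_lt_of_rates` — stated there with LIMITS of the rates). A certificate never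
produces limits; it produces one-sided bounds. This file gives the exponent inequality from exactly the bounds a
certificate delivers, and instantiates it for the record ray with everything the tree PROVES plugged in by name and
everything it does NOT prove kept as a labelled hypothesis:

* `abs_sub_div_lt_of_bounds` (generic, any `ξ`): from `|Qₙξ − Pₙ| ≤ e^{ℓn}`, `e^{c⁻n} ≤ |Qₙ| ≤ e^{c⁺n}`, `Dₙ ≤ e^{λn}`
  (all eventually) and `γ·(λ + c⁺) < c⁻ − ℓ`, `γ ≥ 0`: eventually `|ξ − Pₙ/Qₙ| < 1/(Dₙ|Qₙ|)^γ`;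
* `record_exponent` (the record ray): with `Qₙ = recordQ n = Q(a·n)` and `Pₙ = recordP n` (so `Qₙζ(5) − Pₙ = recordForm n`,
  `RecordRayForms.recordForm_eq`, PROVED) and the PROVED growth bounds of `RecordRayGrowth{,Upper}`
  (`c⁻ = 85.0519`, `c⁺ = 85.08768884`), the two remaining inputs are HYPOTHESES, labelled:
  (Hℓ) DECAY `|recordForm n| ≤ e^{ℓn}` eventually — printed `ℓ = −31.55296934…` (BZ Sect. 11; an analytic statement about
  the very-well-poised series, NOT proved in the tree; the elementary route is CERTIFY-HOWTO §9);
  (HD) DENOMINATORS `Dₙ·Pₙ ∈ ℤ`, `0 < Dₙ ≤ e^{λn}` eventually — the cell's proved ladder gives `λ = 55.180` nats/step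
  (census g16/g17, prime-number theorem applied on paper; by-name assembly pending), BZ's (28)–(30) would give `49.606`.
  Conclusion: `|ζ(5) − pₙ/qₙ| < 1/qₙ^γ` for all large `n`, `pₙ = DₙPₙ ∈ ℤ`, `qₙ = Dₙ|Qₙ| ∈ ℕ`, for every
  `γ ≥ 0` with `γ·(λ + 85.08768884) < 85.0519 − ℓ`;
* `record_exponent_ladder` / `record_exponent_BZ` — the arithmetic of the two headline instances, kernel-checked:
  `ℓ = −31.55296934`, `λ = 55.180` admits every `γ ≤ 0.8313`; `λ = 49.606` admits every `γ ≤ 0.8657`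
  (the census's `γ_Lean = 0.83156` / BZ's `0.86597135` use the sharp `c⁻ = c⁺`; the `0.036`-nat slack of `c⁻` costs
  `2.6·10⁻⁴`). NO irrationality content: every `γ < 1` (Dirichlet gives exponent 2 for free for irrational `ξ`); the
  content is that THESE explicit `pₙ/qₙ` achieve it — a calibration of the construction, as in BZ Theorem 1.
-/

noncomputable section

open Real Filter Topology

namespace Summit.KontsevichZagierPeriods.Zeta5Search.RecordRay

open Literature.NumberTheory.Transcendental (zetaValue)

/-! ### The exponent inequality from one-sided bounds -/

/-- **Exponent from one-sided bounds.** If eventually `|Qₙξ − Pₙ| ≤ e^{ℓn}`, `e^{c⁻n} ≤ |Qₙ| ≤ e^{c⁺n}` and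
`0 < Dₙ ≤ e^{λn}`, and `γ ≥ 0` satisfies `γ·(λ + c⁺) < c⁻ − ℓ`, then eventually `|ξ − Pₙ/Qₙ| < 1/(Dₙ|Qₙ|)^γ`. -/
theorem abs_sub_div_lt_of_bounds {ξ : ℝ} {Q P D : ℕ → ℝ} {ℓ cl cu lam γ : ℝ}
    (hform : ∀ᶠ n : ℕ in atTop, |Q n * ξ - P n| ≤ Real.exp (ℓ * n))
    (hQl : ∀ᶠ n : ℕ in atTop, Real.exp (cl * n) ≤ |Q n|)
    (hQu : ∀ᶠ n : ℕ in atTop, |Q n| ≤ Real.exp (cu * n))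
    (hD : ∀ᶠ n : ℕ in atTop, 0 < D n ∧ D n ≤ Real.exp (lam * n))
    (hγ : 0 ≤ γ) (hrate : γ * (lam + cu) < cl - ℓ) :
    ∀ᶠ n : ℕ in atTop, |ξ - P n / Q n| < 1 / (D n * |Q n|) ^ γ := by
  filter_upwards [hform, hQl, hQu, hD, eventually_ge_atTop 1] with n h1 h2 h3 h4 hn
  obtain ⟨hDpos, hDle⟩ := h4
  have hQpos : 0 < |Q n| := (Real.exp_pos _).trans_le h2
  have hQne : Q n ≠ 0 := abs_pos.mp hQpos
  have hn' : (1 : ℝ) ≤ n := by exact_mod_cast hn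
  -- |ξ − P/Q| = |Qξ − P|/|Q| ≤ e^{(ℓ − c⁻) n}
  have hsub : |ξ - P n / Q n| = |Q n * ξ - P n| / |Q n| := by
    rw [← abs_div]; congr 1; field_simp
  have hup : |ξ - P n / Q n| ≤ Real.exp ((ℓ - cl) * n) := by
    rw [hsub, div_le_iff₀ hQpos]
    calc |Q n * ξ - P n| ≤ Real.exp (ℓ * n) := h1
      _ = Real.exp ((ℓ - cl) * n) * Real.exp (cl * n) := by rw [← Real.exp_add]; ring_nf
      _ ≤ Real.exp ((ℓ - cl) * n) * |Q n| := by gcongr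
  -- (D|Q|)^γ ≤ e^{γ(λ + c⁺) n}
  have hq : 0 < D n * |Q n| := mul_pos hDpos hQpos
  have hpow : (D n * |Q n|) ^ γ ≤ Real.exp (γ * (lam + cu) * n) := by
    calc (D n * |Q n|) ^ γ ≤ (Real.exp (lam * n) * Real.exp (cu * n)) ^ γ := by
          apply Real.rpow_le_rpow hq.le _ hγ
          exact mul_le_mul hDle h3 hQpos.le (Real.exp_pos _).le
      _ = Real.exp (γ * (lam + cu) * n) := by
          rw [← Real.exp_add, ← Real.exp_mul]; ring_nf
  have hpowpos : 0 < (D n * |Q n|) ^ γ := Real.rpow_pos_of_pos hq γ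
  -- combine: e^{(ℓ−c⁻)n} < e^{−γ(λ+c⁺)n} ≤ 1/(D|Q|)^γ
  have hlt : Real.exp ((ℓ - cl) * n) < 1 / Real.exp (γ * (lam + cu) * n) := by
    rw [one_div, ← Real.exp_neg, Real.exp_lt_exp]; nlinarith
  calc |ξ - P n / Q n| ≤ Real.exp ((ℓ - cl) * n) := hup
    _ < 1 / Real.exp (γ * (lam + cu) * n) := hlt
    _ ≤ 1 / (D n * |Q n|) ^ γ := one_div_le_one_div_of_le hpowpos hpow

/-! ### The record ray -/

/-- **The record ray's effective exponent, conditional form.** PROVED inputs: the form identity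
`recordForm n = Q(a·n)ζ(5) − Pₙ` and the growth bounds `e^{(85.0519−ε)n} ≤ |Q(a·n)| ≤ e^{(85.08768884+ε)n}`.
HYPOTHESES (labelled, not proved in the tree): (Hℓ) the decay `|recordForm n| ≤ e^{ℓn}` eventually; (HD) denominators
`Dₙ` with `DₙPₙ ∈ ℤ` and `0 < Dₙ ≤ e^{λn}` eventually. CONCLUSION: for every `γ ≥ 0` with `γ(λ + 85.08768884) < 85.0519 − ℓ`,
eventually there are integers `pₙ = DₙPₙ`, `qₙ = Dₙ|Q(a·n)| ≥ 1` with `pₙ/qₙ = ±Pₙ/Qₙ` hence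
`|ζ(5) − Pₙ/Q(a·n)| < 1/qₙ^γ`. -/
theorem record_exponent {ℓ lam γ : ℝ} (D : ℕ → ℕ)
    (hℓ : ∀ᶠ n : ℕ in atTop, |recordForm n| ≤ Real.exp (ℓ * n))
    (hD : ∀ᶠ n : ℕ in atTop, 0 < D n ∧ (∃ z : ℤ, (D n : ℚ) * recordP n = z) ∧ (D n : ℝ) ≤ Real.exp (lam * n))
    (hγ : 0 ≤ γ) (hrate : γ * (lam + 8508768884 / 10 ^ 8) < 850519 / 10 ^ 4 - ℓ) :
    ∀ᶠ n : ℕ in atTop, ∃ p : ℤ, ∃ q : ℕ, 1 ≤ q ∧ (q : ℤ) = D n * |recordQ n| ∧ (p : ℚ) = D n * recordP n ∧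
      |zetaValue 5 - (recordP n : ℝ) / (recordQ n : ℝ)| < 1 / (q : ℝ) ^ γ := by
  -- room: shrink the proved rates by ε
  obtain ⟨ε, hε, hrate'⟩ : ∃ ε : ℝ, 0 < ε ∧
      γ * (lam + (8508768884 / 10 ^ 8 + ε)) < (850519 / 10 ^ 4 - ε) - ℓ := by
    refine ⟨(850519 / 10 ^ 4 - ℓ - γ * (lam + 8508768884 / 10 ^ 8)) / (2 * (γ + 1)), ?_, ?_⟩
    · apply div_pos (by linarith) (by positivity)
    · have hg1 : 0 < γ + 1 := by linarith
      field_simp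
      nlinarith
  have hform : ∀ᶠ n : ℕ in atTop, |(recordQ n : ℝ) * zetaValue 5 - (recordP n : ℝ)| ≤ Real.exp (ℓ * n) := by
    filter_upwards [hℓ, eventually_ge_atTop 1] with n hn hn1
    rwa [recordForm_eq hn1] at hn
  have hD' : ∀ᶠ n : ℕ in atTop, 0 < (D n : ℝ) ∧ (D n : ℝ) ≤ Real.exp (lam * n) := by
    filter_upwards [hD] with n hn; exact ⟨by exact_mod_cast hn.1, hn.2.2⟩
  have key := abs_sub_div_lt_of_bounds (ξ := zetaValue 5) (Q := fun n => (recordQ n : ℝ)) (P := fun n => (recordP n : ℝ))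
    (D := fun n => (D n : ℝ)) hform (eventually_exp_le_abs_recordQ hε) (eventually_abs_recordQ_le_exp hε) hD' hγ hrate'
  filter_upwards [key, hD] with n hn hDn
  obtain ⟨hDpos, ⟨z, hz⟩, -⟩ := hDn
  refine ⟨z, D n * (recordQ n).natAbs, ?_, ?_, hz.symm, ?_⟩
  · have hQ : recordQ n ≠ 0 := by
      have := abs_recordQ_pos n
      intro h; rw [h] at this; simp at this
    exact Nat.one_le_iff_ne_zero.mpr (Nat.mul_ne_zero hDpos.ne' (Int.natAbs_ne_zero.mpr hQ))
  · simp
  · have hcast : ((D n * (recordQ n).natAbs : ℕ) : ℝ) = (D n : ℝ) * |(recordQ n : ℝ)| := by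
      push_cast; rw [Nat.cast_natAbs, Int.cast_abs]
    rw [hcast]
    exact hn

/-- **Headline arithmetic 1 (proved ladder).** With the printed decay `ℓ = −31.55296934` and the census's proved
denominator rate `λ = 55.180` nats/step, every exponent `γ ≤ 0.8313` satisfies the rate condition of `record_exponent`
(the census's `γ_Lean = 0.83156` uses the sharp `c⁻ = c⁺ = 85.0877`). -/
theorem record_exponent_ladder {γ : ℝ} (hγ : γ ≤ 8313 / 10 ^ 4) :
    γ * (55180 / 10 ^ 3 + 8508768884 / 10 ^ 8) < 850519 / 10 ^ 4 - (-3155296934 / 10 ^ 8 : ℝ) := by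
  nlinarith

/-- **Headline arithmetic 2 (Brown–Zudilin's denominators).** With `ℓ = −31.55296934` and BZ's (28)–(30) rate
`λ = C₂ = 49.606` (conjectural savings), every `γ ≤ 0.8657` satisfies the rate condition (printed worthiness `0.86597135`). -/
theorem record_exponent_BZ {γ : ℝ} (hγ : γ ≤ 8657 / 10 ^ 4) :
    γ * (49606 / 10 ^ 3 + 8508768884 / 10 ^ 8) < 850519 / 10 ^ 4 - (-3155296934 / 10 ^ 8 : ℝ) := by
  nlinarith

end Summit.KontsevichZagierPeriods.Zeta5Search.RecordRay
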